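import Literature.MathematicalPhysics.QuantumFieldTheory.Balaban1983to89.T4ContinuumYM4Torus
import Summits.QuantumFields.BalabanUV.Gaps.EndRunwiseCone
import Summits.QuantumFields.BalabanUV.Gaps.EndTopRunCriterion

/-!
# Gaps / EndRunwiseHeadline — the T⁴ headline's β-binder `hEnd` in the gen-6 currencies: from (PS) ALONG IN-INTERVAL RUNS, from the SIGN ON
# NON-DECREASING HISTORIES, Theorem 2's printed shape for the datum from bounds on the RUNNING CONE, and — for non-crossing data — `hEnd`
# EQUIVALENT to «no backsliding from the top»
# (cell pub-balaban-gaps, seat g1-p3 gen 6, row CAP+tail ∕ β-currency «split ∕ weakening»; datum-level transport of `Gaps/EndRunwiseShooting` ∕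
# `EndRunwiseCone` ∕ `EndTopRunCriterion`, as `Gaps/WeakestBetaCurrency` (SK-W) was for W-β)

HONEST FRAMING (cell rule, page 1 of everything): the target is ONE kernel implication on ONE finite four-torus of fixed physical size —
`T4ContinuumYM4Torus.continuumYM4_torus_of_endpointExistence` (:814) — whose binders (B1) `hD`, (B) `hB`, `hEnd`, (NE7-slot) `hNE` are OPEN.
This module DISCHARGES NOTHING: it feeds `hEnd` (resp. `B12.Thm2Printed D.C.toB12`) from β-side hypotheses on the datum's OWN family
`D.βfun` that are WEAKER than W-β (run-wise (PS); cone sign; cone bounds) or, on non-crossing data, EQUIVALENT to it (top runs) — every one a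
BINDER, instance 0∕1 for Bałaban's family; the other binders stay hypotheses verbatim.  [I] Thm 2 is UNPROVED in print; 0∕13 main theorems,
0∕9 spine estimates, 0∕6 binders; one finite T⁴; NOT ℝ⁴, NOT infinite volume, NOT a mass gap, NOT Clay.
HONEST DEPENDENCY (b2b cell, verbatim): «continuum YM on T⁴ ⇐ BetaPertH ∧ nine spine estimates (0/9 proved); BetaPertH ⇐ (D1) ∧ (D4) ∧
CAP+tail; G-an2-4 gates asym, D1 and NE2/3/4.»

CONTENT (forward generation is the datum's FIELD `D.fwd`, the dictionary its FIELD `D.curries`; `HaltsOutside` — the third modelling clause of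
`FlowStepRuns`, met by `modelOf` — is NOT a field and enters the iff as a hypothesis):
* §0 `endpointExistence_of_topRunsGstar` — construction level, `ForwardGenerated` only: the top-run condition in `g⋆`-form (per level some
  `g⋆ > 0` below which no in-interval run sitting at `γ` ends) ⟹ `EndpointExistence C`; the `hord`-free direction of the criterion by name
  (g1-plan-2 X-97 P-1); datum form `endpointExistence_of_topRuns_datum`.
* §1 `endpointExistence_of_runwisePS_datum` ∕ `continuumYM4Torus_of_runwisePS` — `hEnd` and the NON-VACUOUS headline from (PS) asked only along
  in-interval runs of (0.20) (+ (U) + (C)); `…_of_monotoneSign_datum` ∕ `continuumYM4Torus_of_monotoneSign` — from the SIGN on non-decreasing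
  histories (+ printed (U) + (C)).
  `thm2Printed_of_coneBounds_datum` — [I] Thm 2's printed shape `B12.Thm2Printed D.C.toB12 L` for every `L > 1` from `0 < b ≤ β ≤ β′` on the
  RUNNING CONE + box continuity (rows CAP ∕ tail ∕ (D1) ∕ (D4) may be cone-restricted).
  `endpointExistence_datum_iff_topRuns` — with `HaltsOutside` and non-crossing at every small level: `hEnd ↔` «∃ γ₂ ∀ γ ≤ γ₂ ∃ g⋆ > 0: no
  in-interval run of (0.20) in ]0,γ] that sits at γ ends below g⋆» — the END binder of the headline as an EQUIVALENT β-side statement.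
* §2 the NON-VACUOUS headline in three currencies (`continuumYM4Torus_of_runwisePS` ∕ `_of_monotoneSign` ∕ `_of_topRuns`).
0 sorry; 0 def; imports `T4ContinuumYM4Torus` + the two gen-6 proof files; restates nothing.

CITATION HEADER (tags CONTEXT ONLY).  [I] = T. Bałaban, Commun. Math. Phys. **109** (1987) [Balaban1987RG1]: Thm 2 ∕ (0.31) p. 259,
(0.20) p. 256; [II] = Commun. Math. Phys. **122** (1989) [Balaban1989LargeFieldII] p. 355 (Thm 2 «has not been published yet»).
-/

namespace Summit.QuantumFields.BalabanUV.Gaps.EndRunwiseHeadline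

open Literature.MathematicalPhysics.QuantumFieldTheory.Balaban1983to89
open Literature.MathematicalPhysics.QuantumFieldTheory.Balaban1983to89.FlowStep
open Literature.MathematicalPhysics.QuantumFieldTheory.Balaban1983to89.FlowStepRuns
open Literature.MathematicalPhysics.QuantumFieldTheory.Balaban1983to89.DagBinding
open Literature.MathematicalPhysics.QuantumFieldTheory.Balaban1983to89.T4Continuum
open Literature.MathematicalPhysics.QuantumFieldTheory.Balaban1983to89.T4ContinuumYM4Torus
open Summit.QuantumFields.BalabanUV.Gaps.EndRunwiseShooting
open Summit.QuantumFields.BalabanUV.Gaps.EndRunwiseCone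
open Summit.QuantumFields.BalabanUV.Gaps.EndTopRunCriterion
open Finset

universe u

noncomputable section

/-! ## §0 The top-run condition in `g⋆`-form, construction level (no non-crossing needed in this direction; g1-plan-2 X-97 P-1) -/

/-- **`DagBinding.EndpointExistence` FROM THE TOP-RUN CONDITION IN `g⋆`-FORM** (construction level, `ForwardGenerated` only): `β` jointly
continuous and `≤ β′` on the boxes `]0,γ₀]^{k+1}`, and for EACH level `γ ≤ γ₀` some `g⋆ > 0` such that no in-interval (`]0,γ]`) solution of (0.20)
that sits at `γ` at a step `k ≤ n` ends below `g⋆` ⟹ `EndpointExistence C`.  (= `EndRunwiseShooting.endpointExistence_of_topRunsPerLevel` with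
`M_γ = 1∕min(g⋆,γ)² − 1∕γ²`; the `hord`-free direction of `EndTopRunCriterion.endpointExistence_iff_topRuns`, BY NAME.) [cite: Balaban1987RG1, Thm 2 p.259] -/
theorem endpointExistence_of_topRunsGstar {C : B12.Construction} {β : HBeta} (hgen : ForwardGenerated C β) {γ₀ β' : ℝ}
    (hγ₀ : 0 < γ₀) (hβ' : 0 ≤ β') (hcont : BetaContH γ₀ β) (hhi : BetaUpperH β' γ₀ β)
    (htop : ∀ γ : ℝ, 0 < γ → γ ≤ γ₀ → ∃ gstar : ℝ, 0 < gstar ∧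
      ∀ (n : ℕ) (gs : ℕ → ℝ), RGEqH n β gs → Step.InInterval γ n gs → ∀ k, k ≤ n → gs k = γ → gstar ≤ gs n) :
    EndpointExistence C := by
  refine endpointExistence_of_topRunsPerLevel hgen hγ₀ hβ' hcont hhi fun γ hγ hγle => ?_
  obtain ⟨gstar, hgstar, h⟩ := htop γ hγ hγle
  have hmpos : 0 < min gstar γ := lt_min hgstar hγ
  refine ⟨1 / (min gstar γ) ^ 2 - 1 / γ ^ 2, ?_, fun n gs hrg hI k hk hgk => ?_⟩
  · have := one_div_le_one_div_of_le (pow_pos hmpos 2) (pow_le_pow_left₀ hmpos.le (min_le_right _ _) 2)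
    linarith
  · have hend : min gstar γ ≤ gs n := (min_le_left _ _).trans (h n gs hrg hI k hk hgk)
    have ht := inv_sq_telescopeH hrg hk le_rfl
    have h1 : 1 / (gs n) ^ 2 ≤ 1 / (min gstar γ) ^ 2 :=
      one_div_le_one_div_of_le (pow_pos hmpos 2) (pow_le_pow_left₀ hmpos.le hend 2)
    have h2 : 1 / (gs k) ^ 2 = 1 / γ ^ 2 := by rw [hgk]
    linarith

/-! ## §1 `hEnd` and the non-vacuous headline from run-wise (PS) and from the cone sign -/

section Datum

variable {F : T4Family} {G : Type u} [GaugeGroup G] [MeasurableSpace G] [HaarData G]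

/-- **`hEnd` FROM RUN-WISE (PS)** for a finite-ε datum: (PS) asked only ALONG IN-INTERVAL RUNS of (0.20) of the datum's own β-family (+ the
printed upper bound + continuity on the boxes `]0,γ₀]^{k+1}`) ⟹ `EndpointExistence D.C.toB12` (forward generation is the field `D.fwd`).
Weaker binder than W-β's all-history (PS) (`Gaps/WeakestBetaCurrency.endpointExistence_of_W`). [cite: Balaban1987RG1, Thm 2 p.259] -/
theorem endpointExistence_of_runwisePS_datum (D : FiniteEpsData F G) {γ₀ M β' : ℝ} (hγ₀ : 0 < γ₀) (hM : 0 ≤ M) (hβ' : 0 ≤ β')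
    (hcont : BetaContH γ₀ D.βfun) (hhi : BetaUpperH β' γ₀ D.βfun)
    (hrun : ∀ (n : ℕ) (gs : ℕ → ℝ), RGEqH n D.βfun gs → Step.InInterval γ₀ n gs →
      ∀ k, k ≤ n → -M ≤ ∑ j ∈ Finset.Ico k n, D.βfun j (prefixOf gs j)) :
    EndpointExistence D.C.toB12 :=
  endpointExistence_of_runwisePS D.fwd hγ₀ hM hβ' hcont hhi hrun

/-- **`hEnd` FROM THE SIGN ON NON-DECREASING HISTORIES** for a finite-ε datum: `0 ≤ β_{k+1}(g_0,…,g_k)` asked only where `g_0 ≤ … ≤ g_k ≤ γ₀`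
(+ printed upper bound + box continuity) ⟹ `EndpointExistence D.C.toB12`. [cite: Balaban1987RG1, Thm 2 p.259] -/
theorem endpointExistence_of_monotoneSign_datum (D : FiniteEpsData F G) {γ₀ β' : ℝ} (hγ₀ : 0 < γ₀) (hβ' : 0 ≤ β')
    (hcont : BetaContH γ₀ D.βfun) (hhi : BetaUpperH β' γ₀ D.βfun)
    (hsign : ∀ (k : ℕ) (gs : ℕ → ℝ), (∀ i, i ≤ k → 0 < gs i ∧ gs i ≤ γ₀) →
      (∀ i j, i ≤ j → j ≤ k → gs i ≤ gs j) → 0 ≤ D.βfun k (prefixOf gs k)) :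
    EndpointExistence D.C.toB12 :=
  endpointExistence_of_monotoneSign D.fwd hγ₀ hβ' hcont hhi hsign

/-- **[I] THM 2's PRINTED SHAPE FOR THE DATUM FROM CONE BOUNDS**: `0 < b ≤ β′`, box continuity, and `b ≤ β_{k+1} ≤ β′` asked ONLY for histories in
`]0,γ₀]` already obeying the discrete (0.31) `b ≤ 1∕g_j² − 1∕g_{j+1}² ≤ β′` (`j < k`) ⟹ `B12.Thm2Printed D.C.toB12 L` for every `L > 1` (the block
size lives in the construction; `Gaps/CapFreeLargeL.thm2Printed_iff_of_one_lt`).  The inductive form of the located unprinted input of rows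
CAP ∕ tail ∕ (D1) ∕ (D4); a REDUCTION, not a proof of Theorem 2. [cite: Balaban1987RG1, Thm 2 (0.31) p.259] -/
theorem thm2Printed_of_coneBounds_datum (D : FiniteEpsData F G) {L γ₀ b β' : ℝ} (hL : 1 < L) (hγ₀ : 0 < γ₀) (hb : 0 < b)
    (hbβ' : b ≤ β') (hcont : BetaContH γ₀ D.βfun)
    (hcone : ∀ (k : ℕ) (gs : ℕ → ℝ), (∀ i, i ≤ k → 0 < gs i ∧ gs i ≤ γ₀) →
      (∀ j, j < k → b ≤ 1 / (gs j) ^ 2 - 1 / (gs (j + 1)) ^ 2 ∧ 1 / (gs j) ^ 2 - 1 / (gs (j + 1)) ^ 2 ≤ β') →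
      b ≤ D.βfun k (prefixOf gs k) ∧ D.βfun k (prefixOf gs k) ≤ β') :
    B12.Thm2Printed D.C.toB12 L :=
  thm2Printed_of_coneBoundsH D.fwd hL hγ₀ hb hbβ' hcont hcone

/-- **`hEnd` FROM THE TOP-RUN CONDITION** for a finite-ε datum (no non-crossing needed): for every level `γ ≤ γ₀` some `g⋆ > 0` below which no
in-interval run of (0.20) of `D.βfun` sitting at `γ` ends (+ (U) + (C)) ⟹ `EndpointExistence D.C.toB12`. [cite: Balaban1987RG1, Thm 2 p.259] -/
theorem endpointExistence_of_topRuns_datum (D : FiniteEpsData F G) {γ₀ β' : ℝ} (hγ₀ : 0 < γ₀) (hβ' : 0 ≤ β')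
    (hcont : BetaContH γ₀ D.βfun) (hhi : BetaUpperH β' γ₀ D.βfun)
    (htop : ∀ γ : ℝ, 0 < γ → γ ≤ γ₀ → ∃ gstar : ℝ, 0 < gstar ∧
      ∀ (n : ℕ) (gs : ℕ → ℝ), RGEqH n D.βfun gs → Step.InInterval γ n gs → ∀ k, k ≤ n → gs k = γ → gstar ≤ gs n) :
    EndpointExistence D.C.toB12 :=
  endpointExistence_of_topRunsGstar D.fwd hγ₀ hβ' hcont hhi htop

/-- **`hEnd` ⟺ «NO BACKSLIDING FROM THE TOP» FOR A NON-CROSSING DATUM.**  For a finite-ε datum whose construction halts outside (the third modelling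
clause of `FlowStepRuns`; forward generation and the dictionary are the fields `D.fwd`, `D.curries`), with `D.βfun` jointly continuous and
`≤ β′` on `]0,γ₀]^{k+1}` and its in-interval runs non-crossing at every level `γ ≤ γ₀` (e.g. Markov and Lipschitz in the coupling,
`EndTopRunCriterion.anti_of_lipschitz`): `EndpointExistence D.C.toB12 ↔ ∃ γ₂ > 0, ∀ γ ∈ ]0,γ₂], ∃ g⋆ > 0, every in-interval (]0,γ]) solution
of (0.20) that sits at γ at a step k ≤ n has g_n ≥ g⋆` — the headline's β-binder as an EQUIVALENT statement about the top runs of the flow.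
[cite: Balaban1987RG1, Thm 2 p.259] -/
theorem endpointExistence_datum_iff_topRuns (D : FiniteEpsData F G) (hhalt : HaltsOutside D.C.toB12 D.βfun) {γ₀ β' : ℝ}
    (hγ₀ : 0 < γ₀) (hβ' : 0 ≤ β') (hcont : BetaContH γ₀ D.βfun) (hhi : BetaUpperH β' γ₀ D.βfun)
    (hord : ∀ γ : ℝ, 0 < γ → γ ≤ γ₀ → ∀ (n : ℕ) (gs gs' : ℕ → ℝ), RGEqH n D.βfun gs → RGEqH n D.βfun gs' →
      Step.InInterval γ n gs → Step.InInterval γ n gs' → gs 0 < gs' 0 → ∀ k, k ≤ n → gs k < gs' k) :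
    EndpointExistence D.C.toB12 ↔
      ∃ γ₂ : ℝ, 0 < γ₂ ∧ ∀ γ : ℝ, 0 < γ → γ ≤ γ₂ → ∃ gstar : ℝ, 0 < gstar ∧
        ∀ (n : ℕ) (gs : ℕ → ℝ), RGEqH n D.βfun gs → Step.InInterval γ n gs → ∀ k, k ≤ n → gs k = γ → gstar ≤ gs n :=
  endpointExistence_iff_topRuns D.fwd hhalt D.curries hγ₀ hβ' hcont hhi hord

end Datum

/-! ## §2 The non-vacuous T⁴ headline in the gen-6 currencies -/

section DatumSU

variable {F : T4Family} {N : ℕ} [NeZero N]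

/-- **THE T⁴ HEADLINE FROM RUN-WISE (PS), NON-VACUOUS** (∀-form ∧ ∃-form): printed-averaged datum on `SU(N)`, (B), run-wise (PS) of `D.βfun`
(+ (U) + (C)), and the spine slot under endpoint existence ⇒ `ContinuumYM4Torus D ∧ ContinuumYM4TorusE D`
(= `continuumYM4_torus_of_endpointExistence_nonvacuous` :821 with `hEnd := endpointExistence_of_runwisePS_datum …`).  Versus
`WeakestBetaCurrency.continuumYM4Torus_of_W`: the (PS) quarter is asked along in-interval runs only.  Every binder a hypothesis.
[cite: Balaban1987RG1, Thm 2 p.259] -/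
theorem continuumYM4Torus_of_runwisePS (D : FiniteEpsData F (Matrix.specialUnitaryGroup (Fin N) ℂ)) (hD : D.IsPrintedAveraged)
    (hB : B16.EndStatementBPrinted D.C) {γ₀ M β' : ℝ} (hγ₀ : 0 < γ₀) (hM : 0 ≤ M) (hβ' : 0 ≤ β')
    (hcont : BetaContH γ₀ D.βfun) (hhi : BetaUpperH β' γ₀ D.βfun)
    (hrun : ∀ (n : ℕ) (gs : ℕ → ℝ), RGEqH n D.βfun gs → Step.InInterval γ₀ n gs →
      ∀ k, k ≤ n → -M ≤ ∑ j ∈ Finset.Ico k n, D.βfun j (prefixOf gs j))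
    (hNE : T4ApexHybrid.HybridNE7Under D (EndpointExistence D.C.toB12)) : ContinuumYM4Torus D ∧ ContinuumYM4TorusE D :=
  continuumYM4_torus_of_endpointExistence_nonvacuous D hD hB
    (endpointExistence_of_runwisePS_datum D hγ₀ hM hβ' hcont hhi hrun) hNE

/-- **THE T⁴ HEADLINE FROM THE SIGN ON NON-DECREASING HISTORIES, NON-VACUOUS**: printed-averaged datum on `SU(N)`, (B), `0 ≤ β_{k+1}` on
non-decreasing histories in `]0,γ₀]` (+ printed (U) + (C)), and the spine slot ⇒ `ContinuumYM4Torus D ∧ ContinuumYM4TorusE D`.  Versus the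
whole-box sign ∕ asymptotic-freedom roads of the tree.  Every binder a hypothesis. [cite: Balaban1987RG1, Thm 2 p.259] -/
theorem continuumYM4Torus_of_monotoneSign (D : FiniteEpsData F (Matrix.specialUnitaryGroup (Fin N) ℂ)) (hD : D.IsPrintedAveraged)
    (hB : B16.EndStatementBPrinted D.C) {γ₀ β' : ℝ} (hγ₀ : 0 < γ₀) (hβ' : 0 ≤ β')
    (hcont : BetaContH γ₀ D.βfun) (hhi : BetaUpperH β' γ₀ D.βfun)
    (hsign : ∀ (k : ℕ) (gs : ℕ → ℝ), (∀ i, i ≤ k → 0 < gs i ∧ gs i ≤ γ₀) →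
      (∀ i j, i ≤ j → j ≤ k → gs i ≤ gs j) → 0 ≤ D.βfun k (prefixOf gs k))
    (hNE : T4ApexHybrid.HybridNE7Under D (EndpointExistence D.C.toB12)) : ContinuumYM4Torus D ∧ ContinuumYM4TorusE D :=
  continuumYM4_torus_of_endpointExistence_nonvacuous D hD hB
    (endpointExistence_of_monotoneSign_datum D hγ₀ hβ' hcont hhi hsign) hNE

/-- **THE T⁴ HEADLINE FROM THE TOP-RUN CONDITION, NON-VACUOUS** (no non-crossing needed in this direction): printed-averaged datum on `SU(N)`,
(B), `D.βfun` continuous and `≤ β′` on `]0,γ₀]^{k+1}`, and for every level `γ ≤ γ₀` some `g⋆ > 0` below which no in-interval run sitting at `γ`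
ends, and the spine slot ⇒ `ContinuumYM4Torus D ∧ ContinuumYM4TorusE D` (via `endpointExistence_of_topRuns_datum`).  Every binder a
hypothesis. [cite: Balaban1987RG1, Thm 2 p.259] -/
theorem continuumYM4Torus_of_topRuns (D : FiniteEpsData F (Matrix.specialUnitaryGroup (Fin N) ℂ)) (hD : D.IsPrintedAveraged)
    (hB : B16.EndStatementBPrinted D.C) {γ₀ β' : ℝ} (hγ₀ : 0 < γ₀) (hβ' : 0 ≤ β')
    (hcont : BetaContH γ₀ D.βfun) (hhi : BetaUpperH β' γ₀ D.βfun)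
    (htop : ∀ γ : ℝ, 0 < γ → γ ≤ γ₀ → ∃ gstar : ℝ, 0 < gstar ∧
      ∀ (n : ℕ) (gs : ℕ → ℝ), RGEqH n D.βfun gs → Step.InInterval γ n gs → ∀ k, k ≤ n → gs k = γ → gstar ≤ gs n)
    (hNE : T4ApexHybrid.HybridNE7Under D (EndpointExistence D.C.toB12)) : ContinuumYM4Torus D ∧ ContinuumYM4TorusE D :=
  continuumYM4_torus_of_endpointExistence_nonvacuous D hD hB
    (endpointExistence_of_topRuns_datum D hγ₀ hβ' hcont hhi htop) hNE

end DatumSU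

end

end Summit.QuantumFields.BalabanUV.Gaps.EndRunwiseHeadline
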